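import Literature.NumberTheory.Sieve.BombieriVinogradovMoebius
import HarnessLib

/-!
# Route `LeeYangFibres`, crux `RelativeDimOne` (stmt-Parity-14113), line `single-moebius-split`:
# helper file 8 for the stub `stub_moebiusTermBV` — growth lemmas and term-wise bookkeeping

Elementary eventual inequalities in the integer parameter `N → ∞`, and the pointwise estimates of the
four terms of the explicit bound `moebiusTermSum_le_explicit` (helper file 7), used to turn that bound
into `o(N)`:

* `eventually_log_pow_mul_exp_neg_sqrt_le` — `(log N)^p exp(−c √(η log N)) ≤ ε` eventually
  (the Goldston–Yıldırım / de la Vallée Poussin saving beats every power of `log N`);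
* `eventually_log_pow_le_rpow_nat`, `eventually_le_rpow_nat`, `eventually_le_log_nat`,
  `eventually_nat_of_eventually_real_mul`, `mtb_eventually_log_pow_mul_rpow_le` — log-powers against
  powers, constants against powers and logarithms, transfer of real eventualities along `N ↦ aN`,
  and `C (log N)^p N^a ≤ ε N` eventually for `a < 1`;
* `prod_natFloor_rpow_le` — `∏ ⌊N^{δ_i}⌋ ≤ N^{∑ δ_i}` (the number of sieve tuples);
* `mtb_t1_le` … `mtb_t4_le` — the four terms (Bombieri–Vinogradov with multiplicities, divisors below
  `R₀` against all moduli, the Goldston–Yıldırım saving, the point `ψ₀ = 1`) are each `≤ (ε/4) N`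
  given the corresponding eventual inequality; `mtb_range_le` — the level `Q_m ≤ X^{1/2}(log X)^{−B}`;
  `mtb_rmin` — the Möbius range `R_min = N^{δ₀}/(L P)` satisfies `1 ≤ Q_m ≤ R_min`, `log R_min ≥ η log N`;
  `mtb_logs` — `log N ≤ log X ≤ 2 log N`, `1 + log Q_m ≤ 3 log N`.

(`log₂ X ≤ 2 log X` is the tree's `Literature.NumberTheory.LFunctions.MRT2015.natLog_two_le_two_mul_log`.)

References: H. Iwaniec, E. Kowalski, *Analytic Number Theory* (2004), §5.6, Thm. 17.1
[IwaniecKowalski2004]; D. A. Goldston, C. Y. Yıldırım, Integers 3 (2003) A5 [GoldstonYildirim2001].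
-/

noncomputable section

open Filter Finset

namespace Summit.Parity.GeneralizedHardyLittlewood.Cruxes.RelativeDimOne.SingleMoebiusSplit

open Literature.NumberTheory.Sieve.BVMoebius (eventually_log_rpow_le_rpow')

/-- **The `exp(−c√log)` saving beats log-powers**: for `c, η, ε > 0` and `p ∈ ℕ`,
`(log N)^p · exp(−c √(η log N)) ≤ ε` for all large `N`. [folklore] -/
theorem eventually_log_pow_mul_exp_neg_sqrt_le : ∀ (p : ℕ) (c η ε : ℝ), 0 < c → 0 < η → 0 < ε → ∀ᶠ N : ℕ in Filter.atTop, Real.log N ^ p * Real.exp (-c * Real.sqrt (η * Real.log N)) ≤ ε := by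
  intro p c η ε hc hη hε
  -- `g(u) = (u²/η)^p e^{-cu} → 0`
  have hg : Tendsto (fun u : ℝ => (u ^ 2 / η) ^ p * Real.exp (-c * u)) atTop (nhds 0) := by
    have h1 := tendsto_rpow_mul_exp_neg_mul_atTop_nhds_zero (2 * p) c hc
    have h2 : Tendsto (fun u : ℝ => (η ^ p)⁻¹ * (u ^ (2 * (p : ℝ)) * Real.exp (-c * u))) atTop (nhds 0) := by
      simpa using h1.const_mul ((η ^ p)⁻¹)
    refine (h2.congr' ?_)
    filter_upwards [eventually_ge_atTop (0 : ℝ)] with u hu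
    have : u ^ (2 * (p : ℝ)) = (u ^ 2) ^ p := by
      rw [Real.rpow_mul hu, Real.rpow_natCast, Real.rpow_two]
    rw [this, div_pow]
    field_simp
  -- `u(N) = √(η log N) → ∞`
  have hu : Tendsto (fun N : ℕ => Real.sqrt (η * Real.log N)) atTop atTop := by
    refine Real.tendsto_sqrt_atTop.comp ?_
    exact (Real.tendsto_log_atTop.comp tendsto_natCast_atTop_atTop).const_mul_atTop hη
  have hcomp := hg.comp hu
  have hev : ∀ᶠ N : ℕ in atTop, (fun u : ℝ => (u ^ 2 / η) ^ p * Real.exp (-c * u))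
      (Real.sqrt (η * Real.log N)) ≤ ε := hcomp.eventually (eventually_le_nhds hε)
  filter_upwards [hev, eventually_ge_atTop 1] with N hN hN1
  have hlog : 0 ≤ Real.log N := Real.log_natCast_nonneg N
  have hsq : Real.sqrt (η * Real.log N) ^ 2 / η = Real.log N := by
    rw [Real.sq_sqrt (mul_nonneg hη.le hlog)]
    field_simp
  simpa only [hsq] using hN

/-- `(log N)^p ≤ N^s` for all large `N` (`s > 0`). [folklore] -/
theorem eventually_log_pow_le_rpow_nat (p : ℕ) {s : ℝ} (hs : 0 < s) :
    ∀ᶠ N : ℕ in Filter.atTop, Real.log N ^ p ≤ (N : ℝ) ^ s := by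
  have h := (eventually_log_rpow_le_rpow' (p : ℝ) hs)
  have h2 := tendsto_natCast_atTop_atTop (R := ℝ) |>.eventually h
  filter_upwards [h2] with N hN
  rwa [Real.rpow_natCast] at hN

/-- `C ≤ N^s` for all large `N` (`s > 0`). [folklore] -/
theorem eventually_le_rpow_nat (C : ℝ) {s : ℝ} (hs : 0 < s) :
    ∀ᶠ N : ℕ in Filter.atTop, C ≤ (N : ℝ) ^ s :=
  ((tendsto_rpow_atTop hs).comp (tendsto_natCast_atTop_atTop (R := ℝ))).eventually_ge_atTop C

/-- `C ≤ log N` for all large `N`. [folklore] -/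
theorem eventually_le_log_nat (C : ℝ) : ∀ᶠ N : ℕ in Filter.atTop, C ≤ Real.log N :=
  (Real.tendsto_log_atTop.comp (tendsto_natCast_atTop_atTop (R := ℝ))).eventually_ge_atTop C

/-- Transfer of an eventual property of reals along `N ↦ aN` (`a > 0`). [folklore] -/
theorem eventually_nat_of_eventually_real_mul {P : ℝ → Prop} {a : ℝ} (ha : 0 < a)
    (h : ∀ᶠ x : ℝ in Filter.atTop, P x) : ∀ᶠ N : ℕ in Filter.atTop, P (a * N) :=
  ((tendsto_natCast_atTop_atTop (R := ℝ)).const_mul_atTop ha).eventually h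

/-- `∏_i ⌊N^{δ_i}⌋ ≤ N^{∑_i δ_i}` for `N ≥ 1`. [folklore] -/
theorem prod_natFloor_rpow_le {k : ℕ} (δ : Fin k → ℝ) {N : ℝ} (hN : 1 ≤ N) :
    ((∏ i, ⌊N ^ (δ i)⌋₊ : ℕ) : ℝ) ≤ N ^ (∑ i, δ i) := by
  rw [Nat.cast_prod, Real.rpow_sum_of_pos (by linarith) δ Finset.univ]
  exact Finset.prod_le_prod (fun i _ => Nat.cast_nonneg _) fun i _ => Nat.floor_le (by positivity)

/-- **Sub-linear growth**: `C (log N)^p N^a ≤ ε N` for all large `N`, whenever `a < 1` and `ε > 0`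
(the shape of the terms (ii) and (iv) of the explicit bound for the pure-Möbius term). [folklore] -/
theorem mtb_eventually_log_pow_mul_rpow_le : ∀ (p : ℕ) (a C ε : ℝ), a < 1 → 0 < ε → ∀ᶠ N : ℕ in Filter.atTop, C * Real.log N ^ p * (N : ℝ) ^ a ≤ ε * N := by
  intro p a C ε ha hε
  have hb : 0 < (1 - a) / 2 := by linarith
  have h1 : ∀ᶠ N : ℕ in atTop, Real.log N ^ p ≤ (N : ℝ) ^ ((1 - a) / 2) := by
    have h := (tendsto_natCast_atTop_atTop (R := ℝ)).eventually
      (eventually_log_rpow_le_rpow' (p : ℝ) hb)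
    filter_upwards [h] with N hN
    rwa [Real.rpow_natCast] at hN
  have h2 : ∀ᶠ N : ℕ in atTop, |C| / ε ≤ (N : ℝ) ^ ((1 - a) / 2) :=
    ((tendsto_rpow_atTop hb).comp (tendsto_natCast_atTop_atTop (R := ℝ))).eventually_ge_atTop _
  filter_upwards [h1, h2, eventually_ge_atTop 1] with N hN1 hN2 hN3
  have hN : (0 : ℝ) < N := by exact_mod_cast hN3
  have hNa : 0 ≤ (N : ℝ) ^ a := Real.rpow_nonneg hN.le a
  have hlog : 0 ≤ Real.log N := Real.log_natCast_nonneg N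
  have hC : |C| ≤ ε * (N : ℝ) ^ ((1 - a) / 2) := by rwa [div_le_iff₀' hε] at hN2
  have hsplit : (N : ℝ) ^ ((1 - a) / 2) * (N : ℝ) ^ ((1 - a) / 2) * (N : ℝ) ^ a = N := by
    rw [← Real.rpow_add hN, ← Real.rpow_add hN]
    have : (1 - a) / 2 + (1 - a) / 2 + a = 1 := by ring
    rw [this, Real.rpow_one]
  calc C * Real.log N ^ p * (N : ℝ) ^ a ≤ |C| * Real.log N ^ p * (N : ℝ) ^ a :=
        mul_le_mul_of_nonneg_right (mul_le_mul_of_nonneg_right (le_abs_self C) (pow_nonneg hlog p)) hNa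
    _ ≤ ε * (N : ℝ) ^ ((1 - a) / 2) * (N : ℝ) ^ ((1 - a) / 2) * (N : ℝ) ^ a :=
        mul_le_mul_of_nonneg_right (mul_le_mul hC hN1 (pow_nonneg hlog p) (by positivity)) hNa
    _ = ε * ((N : ℝ) ^ ((1 - a) / 2) * (N : ℝ) ^ ((1 - a) / 2) * (N : ℝ) ^ a) := by ring
    _ = ε * N := by rw [hsplit]

/-- Term (i) of the explicit bound (Bombieri–Vinogradov with multiplicities), pointwise: with
`Λ = log X ∈ [ℓ, 2ℓ]`, `1 + log Q_m ≤ 3ℓ`, `X = 2 L N`, `S ≤ C' X/Λ^A`, `A = 2k + 2 + m` and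
`ℓ ≥ 1536 · 3^m L^{2k+2} |C'|/ε²`, one has `ℓ^k · 2 L^k (3 X Λ (1 + log Q_m)^m)^{1/2} S^{1/2} ≤ (ε/4) N`
(compare squares). [folklore] -/
theorem mtb_t1_le : ∀ (k m A : ℕ) (ℓ Λ Lr n ql X S C' ε : ℝ), 1 ≤ ℓ → ℓ ≤ Λ → Λ ≤ 2 * ℓ → 0 ≤ ql → ql ≤ 3 * ℓ → X = 2 * Lr * n → 0 ≤ Lr → 0 ≤ n → 0 ≤ S → S ≤ C' * X / Λ ^ A → A = 2 * k + 2 + m → 0 < ε → 1536 * 3 ^ m * Lr ^ (2 * k + 2) * |C'| / ε ^ 2 ≤ ℓ → ℓ ^ k * (2 * (Lr ^ k * Real.sqrt (3 * X * Λ * ql ^ m) * Real.sqrt S)) ≤ ε / 4 * n := by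
  intro k m A ℓ Λ Lr n ql X S C' ε hℓ hℓΛ hΛ hql0 hql hX hL hn hS0 hS hA hε hbig
  subst hX hA
  have hℓ0 : 0 < ℓ := by linarith
  have hΛ0 : 0 < Λ := by linarith
  have hX0 : 0 ≤ 2 * Lr * n := by positivity
  have ha0 : 0 ≤ 3 * (2 * Lr * n) * Λ * ql ^ m := by positivity
  have hT0 : 0 ≤ ℓ ^ k * (2 * (Lr ^ k * Real.sqrt (3 * (2 * Lr * n) * Λ * ql ^ m) * Real.sqrt S)) := by
    positivity
  have hB0 : 0 ≤ ε / 4 * n := by positivity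
  rw [← Real.sqrt_sq hT0, ← Real.sqrt_sq hB0]
  refine Real.sqrt_le_sqrt ?_
  have hT2 : (ℓ ^ k * (2 * (Lr ^ k * Real.sqrt (3 * (2 * Lr * n) * Λ * ql ^ m) * Real.sqrt S))) ^ 2 =
      4 * Lr ^ (2 * k) * ℓ ^ (2 * k) * (3 * (2 * Lr * n) * Λ * ql ^ m) * S := by
    rw [mul_pow, mul_pow, mul_pow, mul_pow, Real.sq_sqrt ha0, Real.sq_sqrt hS0]; ring
  have h1 : 3 * (2 * Lr * n) * Λ * ql ^ m ≤ 3 * (2 * Lr * n) * (2 * ℓ) * (3 * ℓ) ^ m :=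
    mul_le_mul (mul_le_mul_of_nonneg_left hΛ (by positivity)) (pow_le_pow_left₀ hql0 hql m)
      (by positivity) (by positivity)
  have h2 : S ≤ |C'| * (2 * Lr * n) / ℓ ^ (2 * k + 2 + m) := by
    refine hS.trans ?_
    calc C' * (2 * Lr * n) / Λ ^ (2 * k + 2 + m) ≤ |C'| * (2 * Lr * n) / Λ ^ (2 * k + 2 + m) :=
          div_le_div_of_nonneg_right (mul_le_mul_of_nonneg_right (le_abs_self _) hX0) (by positivity)
      _ ≤ |C'| * (2 * Lr * n) / ℓ ^ (2 * k + 2 + m) :=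
          div_le_div_of_nonneg_left (by positivity) (pow_pos hℓ0 _) (pow_le_pow_left₀ hℓ0.le hℓΛ _)
  rw [hT2]
  calc 4 * Lr ^ (2 * k) * ℓ ^ (2 * k) * (3 * (2 * Lr * n) * Λ * ql ^ m) * S
      ≤ 4 * Lr ^ (2 * k) * ℓ ^ (2 * k) * (3 * (2 * Lr * n) * (2 * ℓ) * (3 * ℓ) ^ m) *
          (|C'| * (2 * Lr * n) / ℓ ^ (2 * k + 2 + m)) :=
        mul_le_mul (mul_le_mul_of_nonneg_left h1 (by positivity)) h2 hS0 (by positivity)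
    _ = (96 * 3 ^ m * Lr ^ (2 * k + 2) * |C'|) * n ^ 2 / ℓ := by
        field_simp
        ring
    _ ≤ (ε / 4 * n) ^ 2 := by
        rw [div_le_iff₀ hℓ0]
        have hn2 : 0 ≤ n ^ 2 := sq_nonneg n
        have hbig' : 1536 * 3 ^ m * Lr ^ (2 * k + 2) * |C'| ≤ ℓ * ε ^ 2 := by
          rwa [div_le_iff₀ (by positivity)] at hbig
        nlinarith [mul_le_mul_of_nonneg_right hbig' hn2]

/-- Term (ii) of the explicit bound (divisors `d ≤ R₀` against all moduli), pointwise: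
`ℓ^k · P · Q_m (log₂ X + 1) log X ≤ 10 L ℓ^{k+2} N^{2s} ≤ (ε/4) N`. [folklore] -/
theorem mtb_t2_le : ∀ (k : ℕ) (ℓ Λ Lr Pr Qr lg ns ns2 ε n : ℝ), 1 ≤ ℓ → 0 ≤ Λ → Λ ≤ 2 * ℓ → 0 ≤ Lr → 0 ≤ Pr → Pr ≤ ns → Qr = Lr * Pr → 0 ≤ lg → lg ≤ 2 * Λ → ns * ns = ns2 → 10 * Lr * ℓ ^ (k + 2) * ns2 ≤ ε / 4 * n → ℓ ^ k * (Pr * (Qr * (lg + 1) * Λ)) ≤ ε / 4 * n := by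
  intro k ℓ Λ Lr Pr Qr lg ns ns2 ε n hℓ hΛ0 hΛ hL hP0 hP hQ hlg0 hlg hns hfin
  subst hQ hns
  have h1 : (lg + 1) * Λ ≤ 10 * ℓ ^ 2 := by
    have := mul_le_mul (show lg + 1 ≤ 5 * ℓ by linarith) hΛ hΛ0 (by linarith : (0 : ℝ) ≤ 5 * ℓ)
    nlinarith
  have h2 : Pr * Pr ≤ ns * ns := mul_le_mul hP hP hP0 (hP0.trans hP)
  have hℓk : 0 ≤ ℓ ^ k := pow_nonneg (by linarith) k
  calc ℓ ^ k * (Pr * (Lr * Pr * (lg + 1) * Λ)) = ℓ ^ k * (Lr * ((Pr * Pr) * ((lg + 1) * Λ))) := by ring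
    _ ≤ ℓ ^ k * (Lr * ((ns * ns) * (10 * ℓ ^ 2))) :=
        mul_le_mul_of_nonneg_left (mul_le_mul_of_nonneg_left
          (mul_le_mul h2 h1 (by positivity) ((hP0.trans hP).trans' le_rfl |> fun h => mul_nonneg h h)) hL) hℓk
    _ = 10 * Lr * ℓ ^ (k + 2) * (ns * ns) := by ring
    _ ≤ ε / 4 * n := hfin

/-- Term (iii) of the explicit bound (the Goldston–Yıldırım saving), pointwise: with `X = 2 L N`,
`1 + log Q_m ≤ 3ℓ`, `log R_min ≥ η ℓ`,
`ℓ^k · X C e^{−c√(log R_min)} L^k (1 + log Q_m)^m ≤ (2 L C L^k 3^m) N ℓ^{k+m} e^{−c√(ηℓ)} ≤ (ε/4) N`.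
[folklore] -/
theorem mtb_t3_le : ∀ (k m : ℕ) (ℓ X Lr n C c lR η ql ε : ℝ), 0 ≤ ℓ → X = 2 * Lr * n → 0 ≤ Lr → 0 ≤ n → 0 ≤ C → 0 ≤ c → η * ℓ ≤ lR → 0 ≤ ql → ql ≤ 3 * ℓ → 0 ≤ ε → ℓ ^ (k + m) * Real.exp (-c * Real.sqrt (η * ℓ)) ≤ ε / (4 * (2 * Lr * C * Lr ^ k * 3 ^ m + 1)) → ℓ ^ k * (X * (C * Real.exp (-c * Real.sqrt lR)) * (Lr ^ k * ql ^ m)) ≤ ε / 4 * n := by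
  intro k m ℓ X Lr n C c lR η ql ε hℓ hX hL hn hC hc hlR hql0 hql hε hsmall
  subst hX
  have hexp : Real.exp (-c * Real.sqrt lR) ≤ Real.exp (-c * Real.sqrt (η * ℓ)) := by
    rw [Real.exp_le_exp]
    have := mul_le_mul_of_nonneg_left (Real.sqrt_le_sqrt hlR) hc
    linarith
  have hqm : ql ^ m ≤ (3 * ℓ) ^ m := pow_le_pow_left₀ hql0 hql m
  set K₃ : ℝ := 2 * Lr * C * Lr ^ k * 3 ^ m with hK₃
  have hK0 : 0 ≤ K₃ := by positivity
  have hfin : K₃ * (ε / (4 * (K₃ + 1))) ≤ ε / 4 := by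
    rw [← mul_div_assoc, div_le_div_iff₀ (by positivity) (by positivity)]
    nlinarith
  calc ℓ ^ k * (2 * Lr * n * (C * Real.exp (-c * Real.sqrt lR)) * (Lr ^ k * ql ^ m))
      = (2 * Lr * C * Lr ^ k) * n * ℓ ^ k * (Real.exp (-c * Real.sqrt lR) * ql ^ m) := by ring
    _ ≤ (2 * Lr * C * Lr ^ k) * n * ℓ ^ k * (Real.exp (-c * Real.sqrt (η * ℓ)) * (3 * ℓ) ^ m) :=
        mul_le_mul_of_nonneg_left (mul_le_mul hexp hqm (by positivity) (Real.exp_pos _).le)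
          (by positivity)
    _ = K₃ * n * (ℓ ^ (k + m) * Real.exp (-c * Real.sqrt (η * ℓ))) := by rw [hK₃]; ring
    _ ≤ K₃ * n * (ε / (4 * (K₃ + 1))) := mul_le_mul_of_nonneg_left hsmall (by positivity)
    _ = (K₃ * (ε / (4 * (K₃ + 1)))) * n := by ring
    _ ≤ ε / 4 * n := mul_le_mul_of_nonneg_right hfin hn

/-- Term (iv) of the explicit bound (the point `ψ₀ = 1` and the divisors below `R₀`), pointwise:
`ℓ^k · P · R₀ (log R₀ + 1) ≤ 2 ℓ^{k+1} N^{s+δ₀} ≤ (ε/4) N`. [folklore] -/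
theorem mtb_t4_le : ∀ (k : ℕ) (ℓ Pr ns r0 lr0 nsd ε n : ℝ), 1 ≤ ℓ → 0 ≤ Pr → Pr ≤ ns → 0 ≤ r0 → 0 ≤ lr0 → lr0 ≤ ℓ → ns * r0 = nsd → 2 * ℓ ^ (k + 1) * nsd ≤ ε / 4 * n → ℓ ^ k * (Pr * (r0 * (lr0 + 1))) ≤ ε / 4 * n := by
  intro k ℓ Pr ns r0 lr0 nsd ε n hℓ hP0 hP hr0 hl0 hl hnsd hfin
  subst hnsd
  have hℓk : 0 ≤ ℓ ^ k := pow_nonneg (by linarith) k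
  have h1 : r0 * (lr0 + 1) ≤ r0 * (2 * ℓ) := mul_le_mul_of_nonneg_left (by linarith) hr0
  calc ℓ ^ k * (Pr * (r0 * (lr0 + 1))) ≤ ℓ ^ k * (ns * (r0 * (2 * ℓ))) :=
        mul_le_mul_of_nonneg_left (mul_le_mul hP h1 (by positivity) (hP0.trans hP)) hℓk
    _ = 2 * ℓ ^ (k + 1) * (ns * r0) := by ring
    _ ≤ ε / 4 * n := hfin

/-- The level of distribution, pointwise: `Q_m ≤ L N^s ≤ X^{1/2}(log X)^{−B}` for `X = 2LN` once
`(log X)^B ≤ X^{1/8}` and `L ≤ N^{1/4 − s}`. [folklore] -/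
theorem mtb_range_le : ∀ (L N : ℕ) (s B Qr : ℝ), 1 ≤ L → 2 * L ≤ N → 0 ≤ Qr → Qr ≤ L * (N : ℝ) ^ s → Real.log ((2 * L * N : ℕ) : ℝ) ^ B ≤ ((2 * L * N : ℕ) : ℝ) ^ (1 / 8 : ℝ) → (L : ℝ) ≤ (N : ℝ) ^ (1 / 4 - s) → Qr ≤ ((2 * L * N : ℕ) : ℝ) ^ (1 / 2 : ℝ) / Real.log ((2 * L * N : ℕ) : ℝ) ^ B := by
  intro L N s B Qr hL hLN hQ0 hQ hlogB hLs
  have hN2 : 2 ≤ N := le_trans (by omega) hLN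
  have hNr : (2 : ℝ) ≤ N := by exact_mod_cast hN2
  have hN0 : (0 : ℝ) < N := by linarith
  have hLr : (1 : ℝ) ≤ L := by exact_mod_cast hL
  have hXeq : ((2 * L * N : ℕ) : ℝ) = 2 * (L : ℝ) * N := by push_cast; ring
  have hNX : (N : ℝ) ≤ ((2 * L * N : ℕ) : ℝ) := by rw [hXeq]; nlinarith
  have hXN2 : ((2 * L * N : ℕ) : ℝ) ≤ (N : ℝ) ^ 2 := by
    rw [hXeq]
    have : (2 * L : ℝ) ≤ N := by exact_mod_cast hLN
    nlinarith
  have hX1 : (1 : ℝ) < ((2 * L * N : ℕ) : ℝ) := by linarith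
  have hpow : 0 < Real.log ((2 * L * N : ℕ) : ℝ) ^ B := Real.rpow_pos_of_pos (Real.log_pos hX1) B
  rw [le_div_iff₀ hpow]
  calc Qr * Real.log ((2 * L * N : ℕ) : ℝ) ^ B ≤ (L * (N : ℝ) ^ s) * ((2 * L * N : ℕ) : ℝ) ^ (1 / 8 : ℝ) :=
        mul_le_mul hQ hlogB hpow.le (by positivity)
    _ ≤ ((N : ℝ) ^ (1 / 4 - s) * (N : ℝ) ^ s) * (N : ℝ) ^ (1 / 4 : ℝ) := by
        refine mul_le_mul (mul_le_mul_of_nonneg_right hLs (by positivity)) ?_ (by positivity)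
          (by positivity)
        calc ((2 * L * N : ℕ) : ℝ) ^ (1 / 8 : ℝ) ≤ ((N : ℝ) ^ 2) ^ (1 / 8 : ℝ) :=
              Real.rpow_le_rpow (by positivity) hXN2 (by norm_num)
          _ = (N : ℝ) ^ (1 / 4 : ℝ) := by
              rw [← Real.rpow_two, ← Real.rpow_mul hN0.le]; norm_num
    _ = (N : ℝ) ^ (1 / 2 : ℝ) := by
        rw [← Real.rpow_add hN0, ← Real.rpow_add hN0]; norm_num
    _ ≤ ((2 * L * N : ℕ) : ℝ) ^ (1 / 2 : ℝ) := Real.rpow_le_rpow hN0.le hNX (by norm_num)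

/-- The Möbius range `R_min = R₀/Q_m = N^{δ₀}/(L P)`, pointwise: `1 ≤ Q_m ≤ R_min`, `R_min Q_m ≤ R₀`,
and `log R_min ≥ η log N` with `η = (δ₀ − s)/2`, once `L² ≤ N^{δ₀ − 2s}` and `log L ≤ η log N`
(here `P ≤ N^s` is the number of sieve tuples). [folklore] -/
theorem mtb_rmin : ∀ (L N P : ℕ) (δ0 s η ℓ : ℝ), 1 ≤ N → 1 ≤ L → 1 ≤ P → (P : ℝ) ≤ (N : ℝ) ^ s → (L : ℝ) ^ 2 ≤ (N : ℝ) ^ (δ0 - 2 * s) → ℓ = Real.log N → η = (δ0 - s) / 2 → Real.log L ≤ η * ℓ → 1 ≤ (N : ℝ) ^ δ0 / ((L * P : ℕ) : ℝ) ∧ (N : ℝ) ^ δ0 / ((L * P : ℕ) : ℝ) * ((L * P : ℕ) : ℝ) ≤ (N : ℝ) ^ δ0 ∧ ((L * P : ℕ) : ℝ) ≤ (N : ℝ) ^ δ0 / ((L * P : ℕ) : ℝ) ∧ η * ℓ ≤ Real.log ((N : ℝ) ^ δ0 / ((L * P : ℕ) : ℝ)) := by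
  intro L N P δ0 s η ℓ hN hL hP hPs hL2 hℓ hη hlogL
  subst hℓ hη
  have hN0 : (0 : ℝ) < N := by exact_mod_cast Nat.lt_of_lt_of_le Nat.zero_lt_one hN
  have hLr : (1 : ℝ) ≤ L := by exact_mod_cast hL
  have hPr : (1 : ℝ) ≤ P := by exact_mod_cast hP
  have hQeq : ((L * P : ℕ) : ℝ) = (L : ℝ) * P := by push_cast; ring
  have hQ1 : (1 : ℝ) ≤ ((L * P : ℕ) : ℝ) := by rw [hQeq]; nlinarith
  have hQ0 : (0 : ℝ) < ((L * P : ℕ) : ℝ) := by linarith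
  have hsq : ((L * P : ℕ) : ℝ) * ((L * P : ℕ) : ℝ) ≤ (N : ℝ) ^ δ0 := by
    have hP2 : (P : ℝ) * P ≤ (N : ℝ) ^ s * (N : ℝ) ^ s :=
      mul_le_mul hPs hPs (by positivity) (by positivity)
    have hsplit : (N : ℝ) ^ (δ0 - 2 * s) * ((N : ℝ) ^ s * (N : ℝ) ^ s) = (N : ℝ) ^ δ0 := by
      rw [← Real.rpow_add hN0, ← Real.rpow_add hN0]; ring_nf
    calc ((L * P : ℕ) : ℝ) * ((L * P : ℕ) : ℝ) = (L : ℝ) ^ 2 * ((P : ℝ) * P) := by rw [hQeq]; ring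
      _ ≤ (N : ℝ) ^ (δ0 - 2 * s) * ((N : ℝ) ^ s * (N : ℝ) ^ s) :=
          mul_le_mul hL2 hP2 (by positivity) (by positivity)
      _ = (N : ℝ) ^ δ0 := hsplit
  have hQR : ((L * P : ℕ) : ℝ) ≤ (N : ℝ) ^ δ0 / ((L * P : ℕ) : ℝ) := by
    rw [le_div_iff₀ hQ0]; exact hsq
  refine ⟨hQ1.trans hQR, le_of_eq (div_mul_cancel₀ _ hQ0.ne'), hQR, ?_⟩
  have hlogP : Real.log P ≤ s * Real.log N := by
    have := Real.log_le_log (by linarith) hPs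
    rwa [Real.log_rpow hN0] at this
  rw [Real.log_div (Real.rpow_pos_of_pos hN0 δ0).ne' hQ0.ne', Real.log_rpow hN0, hQeq,
    Real.log_mul (by linarith) (by linarith)]
  linarith

/-- Logarithmic bookkeeping, pointwise: for `N ≥ 2L`, `log N ≥ 1`, `1 ≤ Q_m ≤ L N^s` (`s ≤ 1`) and
`X = 2LN`: `log N ≤ log X ≤ 2 log N` and `0 ≤ log Q_m`, `1 + log Q_m ≤ 3 log N`. [folklore] -/
theorem mtb_logs : ∀ (L N Qm : ℕ) (s : ℝ), 1 ≤ L → 2 * L ≤ N → 1 ≤ Real.log N → 1 ≤ Qm → (Qm : ℝ) ≤ L * (N : ℝ) ^ s → s ≤ 1 → Real.log N ≤ Real.log ((2 * L * N : ℕ) : ℝ) ∧ Real.log ((2 * L * N : ℕ) : ℝ) ≤ 2 * Real.log N ∧ 0 ≤ Real.log Qm ∧ 1 + Real.log Qm ≤ 3 * Real.log N := by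
  intro L N Qm s hL hLN hlog hQm hQs hs
  have hN2 : 2 ≤ N := le_trans (by omega) hLN
  have hNr : (2 : ℝ) ≤ N := by exact_mod_cast hN2
  have hN0 : (0 : ℝ) < N := by linarith
  have hLr : (1 : ℝ) ≤ L := by exact_mod_cast hL
  have hXeq : ((2 * L * N : ℕ) : ℝ) = 2 * (L : ℝ) * N := by push_cast; ring
  have hNX : (N : ℝ) ≤ ((2 * L * N : ℕ) : ℝ) := by rw [hXeq]; nlinarith
  have h2LN : (2 * L : ℝ) ≤ N := by exact_mod_cast hLN
  have hXN2 : ((2 * L * N : ℕ) : ℝ) ≤ (N : ℝ) ^ 2 := by rw [hXeq]; nlinarith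
  have hlog2 : Real.log ((N : ℝ) ^ 2) = 2 * Real.log N := by
    rw [Real.log_pow]; push_cast; ring
  have hQr1 : (1 : ℝ) ≤ Qm := by exact_mod_cast hQm
  have hQN2 : (Qm : ℝ) ≤ (N : ℝ) ^ 2 := by
    calc (Qm : ℝ) ≤ L * (N : ℝ) ^ s := hQs
      _ ≤ L * (N : ℝ) ^ (1 : ℝ) :=
          mul_le_mul_of_nonneg_left (Real.rpow_le_rpow_of_exponent_le (by linarith) hs) (by linarith)
      _ = L * N := by rw [Real.rpow_one]
      _ ≤ (N : ℝ) ^ 2 := by nlinarith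
  refine ⟨Real.log_le_log hN0 hNX, ?_, Real.log_nonneg hQr1, ?_⟩
  · calc Real.log ((2 * L * N : ℕ) : ℝ) ≤ Real.log ((N : ℝ) ^ 2) := Real.log_le_log (by linarith) hXN2
      _ = 2 * Real.log N := hlog2
  · have := Real.log_le_log (by linarith) hQN2
    rw [hlog2] at this
    linarith

end Summit.Parity.GeneralizedHardyLittlewood.Cruxes.RelativeDimOne.SingleMoebiusSplit
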